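import Literature.NumberTheory.Sieve.DickmanFunctionLocalRatio
import HarnessLib

/-!
# `Ψ(cx, y) = c^{α} Ψ(x, y)(1 + O(1/u))` in the de Bruijn range and in the polylogarithmic saddle range

Topic `Literature/NumberTheory/Sieve`; a PROVED tool file toward `Literature.NumberTheory.Sieve.HTLocalBehaviour`
(Hildebrand–Tenenbaum 1986, Theorem 3: `Ψ(cx, y) = Ψ(x, y) c^{α(x,y)} (1 + O(1/u + log y/y))`, `1 ≤ c ≤ y`).
[HildebrandTenenbaum1986, §6] deduces Theorem 3 from Theorem 1 at `x` and `cx`; we do the same in two ranges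
where Theorem 1, or a substitute, is PROVED in the tree:

* `exists_local_smallU` — **de Bruijn range** `u₀ ≤ u`, `u³ ≤ log y`: from
  `Ψ(x, y) = xρ(u)(1 + O((u²+1)/log y))` (`abs_card_sub_mul_dickmanRho_le`), the local behaviour of `ρ`
  (`abs_dickmanRho_add_mul_exp_sub_le`) and `(1 - α) log y = ξ(u) + O(u/log y)`
  (`exists_abs_one_sub_saddlePoint_mul_log_sub_dickmanXi_le`):
  `|Ψ(cx, y) - c^α Ψ(x, y)| ≤ (K/u) c^α Ψ(x, y)`;
* `exists_local_regimeA` — **polylogarithmic saddle range** `8 (log x)³ ≤ y`, `u ≥ u₀`, `u ≥ (log log y)³`: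
  from Theorem 1 in that range (`exists_card_smooth_saddle_regimeA`) and the comparison of the main terms
  (`exists_abs_log_mainTerm_sub_le`): the same conclusion.

## References

* [HildebrandTenenbaum1986] A. Hildebrand, G. Tenenbaum, Trans. AMS 296 (1986) 265–290, Theorem 3 and §6.
* [Hildebrand1986] A. Hildebrand, J. Number Theory 22 (1986) 289–307, Theorem 1.
-/

noncomputable section

open Real

namespace Literature.NumberTheory.Sieve

set_option maxHeartbeats 3000000 in
/-- **Local behaviour in the de Bruijn range.** There are `K`, `y₀`, `u₀` such that for `y ≥ y₀`, `y ≤ x`,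
`u₀ ≤ u`, `u³ ≤ log y` (`u = log x/log y`) and `1 ≤ c ≤ y`:
`|Ψ(cx, y) - c^{α(x,y)} Ψ(x, y)| ≤ (K log y/log x) c^{α(x,y)} Ψ(x, y)`.
[cite: HildebrandTenenbaum1986, Theorem 3 and §6 (via (1.5))] -/
theorem exists_local_smallU :
    ∃ K : ℝ, ∃ y₀ : ℕ, ∃ u₀ : ℝ, 0 < K ∧ 1 ≤ u₀ ∧ ∀ (x : ℝ) (y : ℕ) (c : ℝ), y₀ ≤ y → (y : ℝ) ≤ x →
      u₀ ≤ Real.log x / Real.log y → (Real.log x / Real.log y) ^ 3 ≤ Real.log y → 1 ≤ c → c ≤ y →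
      |((Nat.smoothNumbersUpTo ⌊c * x⌋₊ (y + 1)).card : ℝ) -
          c ^ saddlePoint x y * ((Nat.smoothNumbersUpTo ⌊x⌋₊ (y + 1)).card : ℝ)| ≤
        K * (Real.log y / Real.log x) *
          (c ^ saddlePoint x y * ((Nat.smoothNumbersUpTo ⌊x⌋₊ (y + 1)).card : ℝ)) := by
  obtain ⟨C₁, c₁, hc₁, y₁, hP⟩ := abs_card_sub_mul_dickmanRho_le
  obtain ⟨CR, uR, hCR0, hR⟩ := abs_dickmanRho_add_mul_exp_sub_le
  obtain ⟨Cξ, yξ, uξ, huξ1, hΞ⟩ := exists_abs_one_sub_saddlePoint_mul_log_sub_dickmanXi_le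
  set C₁' := max C₁ 0 with hC₁'
  have hC₁'0 : 0 ≤ C₁' := le_max_right _ _
  set Cξ' := max Cξ 0 with hCξ'
  have hCξ'0 : 0 ≤ Cξ' := le_max_right _ _
  set Kstar : ℝ := 24 * C₁' + 2 * CR + Cξ' + 1 with hKstar
  have hKstar0 : 0 < Kstar := by positivity
  refine ⟨2 * Kstar, max (max y₁ yξ) 16, max (max 2 (max uR uξ)) (max (4 / c₁ + 1) (max (24 * C₁') (max (2 * CR) Kstar))),
    by positivity, le_trans one_le_two (le_trans (le_max_left _ _) (le_max_left _ _)), ?_⟩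
  intro x y c hy hyx hu hu3 hc1 hcy
  -- thresholds
  have hy₁ : y₁ ≤ y := le_trans (le_trans (le_max_left _ _) (le_max_left _ _)) hy
  have hyξ : yξ ≤ y := le_trans (le_trans (le_max_right _ _) (le_max_left _ _)) hy
  have hy16 : 16 ≤ y := le_trans (le_max_right _ _) hy
  set L := Real.log y with hL
  set u := Real.log x / L with hudef
  have hu2 : 2 ≤ u := le_trans (le_max_left _ _) (le_trans (le_max_left _ _) hu)
  have huR : uR ≤ u := le_trans (le_max_left _ _) (le_trans (le_max_right _ _) (le_trans (le_max_left _ _) hu))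
  have huξ : uξ ≤ u := le_trans (le_max_right _ _) (le_trans (le_max_right _ _) (le_trans (le_max_left _ _) hu))
  have huc₁ : 4 / c₁ + 1 ≤ u := le_trans (le_max_left _ _) (le_trans (le_max_right _ _) hu)
  have huC₁ : 24 * C₁' ≤ u := le_trans (le_max_left _ _) (le_trans (le_max_right _ _) (le_trans (le_max_right _ _) hu))
  have huCR : 2 * CR ≤ u := le_trans (le_max_left _ _) (le_trans (le_max_right _ _) (le_trans (le_max_right _ _) (le_trans (le_max_right _ _) hu)))
  have huK : Kstar ≤ u := le_trans (le_max_right _ _) (le_trans (le_max_right _ _) (le_trans (le_max_right _ _) (le_trans (le_max_right _ _) hu)))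
  have hu1 : 1 ≤ u := by linarith
  have hu0 : 0 < u := by linarith
  have hy16r : (16 : ℝ) ≤ y := by exact_mod_cast hy16
  have hy0 : (0 : ℝ) < y := by linarith
  have hy1 : (1 : ℝ) < y := by linarith
  have hy2 : 2 ≤ y := le_trans (by norm_num) hy16
  have hL1 : 1 < L := by
    rw [hL, Real.lt_log_iff_exp_lt hy0]
    exact lt_of_lt_of_le (Real.exp_one_lt_d9.trans (by norm_num)) hy16r
  have hL0 : 0 < L := by linarith
  have hx1 : 1 < x := by linarith
  have hx0 : 0 < x := by linarith
  have hc0 : 0 < c := by linarith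
  have hcx0 : 0 < c * x := by positivity
  have hlogx : Real.log x = u * L := by rw [hudef]; field_simp
  have hu3' : u ^ 3 ≤ L := hu3
  have huL : u ≤ L := (le_self_pow₀ hu1 (by norm_num : (3 : ℕ) ≠ 0)).trans hu3'
  -- `v = log c/L ∈ [0, 1]`
  set v := Real.log c / L with hv
  have hv0 : 0 ≤ v := div_nonneg (Real.log_nonneg hc1) hL0.le
  have hv1 : v ≤ 1 := by rw [hv, div_le_one hL0]; exact Real.log_le_log hc0 hcy
  have hlogc : Real.log c = v * L := by rw [hv]; field_simp
  have hlogcx : Real.log (c * x) = (u + v) * L := by rw [Real.log_mul hc0.ne' hx0.ne', hlogx, hlogc]; ring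
  have hucx : Real.log (c * x) / L = u + v := by rw [hlogcx]; field_simp
  have hycx : (y : ℝ) ≤ c * x := hyx.trans (le_mul_of_one_le_left hx0.le hc1)
  -- (1)(2) Hildebrand's induction at `x` and `cx`
  have hc₁u : (u + 1) ^ 2 ≤ c₁ * L := by
    have h1 : 4 / c₁ ≤ u := by linarith
    have h2 : 4 ≤ c₁ * u := by rwa [div_le_iff₀ hc₁, mul_comm] at h1
    have h3 : c₁ * u ^ 3 ≤ c₁ * L := mul_le_mul_of_nonneg_left hu3' hc₁.le
    have h4 : 4 * u ^ 2 ≤ c₁ * u * u ^ 2 := mul_le_mul_of_nonneg_right h2 (sq_nonneg u)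
    have h5 : (u + 1) ^ 2 ≤ 4 * u ^ 2 := by nlinarith
    have e : c₁ * u * u ^ 2 = c₁ * u ^ 3 := by ring
    linarith
  have hP1 := hP y x hy₁ hyx (by rw [← hL, ← hudef]; nlinarith)
  have hP2 := hP y (c * x) hy₁ hycx (by rw [← hL, hucx]; nlinarith)
  rw [← hL, ← hudef] at hP1
  rw [← hL, hucx] at hP2
  -- (3) the local behaviour of `ρ`, (4) `(1 - α) L = ξ(u) + O(u/L)`
  have hR1 := hR u v huR hv0 hv1
  have hΞ1 := hΞ x y hyξ hyx (by rw [← hL, hlogx]; nlinarith) (by rw [← hL, hlogx]; nlinarith)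
  rw [← hL, ← hudef] at hΞ1
  set α := saddlePoint x y with hα
  -- positivity
  have hρ1 : 0 < dickmanRho u := dickmanRho_pos u
  have hρ2 : 0 < dickmanRho (u + v) := dickmanRho_pos _
  have hm1 : 0 < x * dickmanRho u := mul_pos hx0 hρ1
  have hm2 : 0 < c * x * dickmanRho (u + v) := mul_pos hcx0 hρ2
  -- relative errors `≤ const/u ≤ 1/2`
  have hE1 : C₁ * (u ^ 2 + 1) / L ≤ 2 * C₁' / u := by
    have h1 : C₁ * (u ^ 2 + 1) / L ≤ C₁' * (u ^ 2 + 1) / L :=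
      div_le_div_of_nonneg_right (mul_le_mul_of_nonneg_right (le_max_left _ _) (by positivity)) hL0.le
    have h2 : C₁' * (u ^ 2 + 1) / L ≤ C₁' * (u ^ 2 + 1) / u ^ 3 :=
      div_le_div_of_nonneg_left (by positivity) (by positivity) hu3'
    have h3 : C₁' * (u ^ 2 + 1) / u ^ 3 ≤ 2 * C₁' / u := by
      rw [div_le_div_iff₀ (by positivity) hu0]
      have h4 := mul_le_mul_of_nonneg_left (le_self_pow₀ hu1 (by norm_num : (3 : ℕ) ≠ 0)) hC₁'0
      have e1 : C₁' * (u ^ 2 + 1) * u = C₁' * u ^ 3 + C₁' * u := by ring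
      have e2 : 2 * C₁' * u ^ 3 = C₁' * u ^ 3 + C₁' * u ^ 3 := by ring
      rw [e1, e2]; linarith
    linarith
  have hE2 : C₁ * ((u + v) ^ 2 + 1) / L ≤ 5 * C₁' / u := by
    have h1 : C₁ * ((u + v) ^ 2 + 1) / L ≤ C₁' * ((u + v) ^ 2 + 1) / L :=
      div_le_div_of_nonneg_right (mul_le_mul_of_nonneg_right (le_max_left _ _) (by positivity)) hL0.le
    have h2 : C₁' * ((u + v) ^ 2 + 1) / L ≤ C₁' * ((u + v) ^ 2 + 1) / u ^ 3 :=
      div_le_div_of_nonneg_left (by positivity) (by positivity) hu3'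
    have h3 : C₁' * ((u + v) ^ 2 + 1) / u ^ 3 ≤ 5 * C₁' / u := by
      rw [div_le_div_iff₀ (by positivity) hu0]
      have h4 : (u + v) ^ 2 + 1 ≤ 5 * u ^ 2 := by nlinarith
      have h5 := mul_le_mul_of_nonneg_left h4 (by positivity : 0 ≤ C₁' * u)
      have e1 : C₁' * ((u + v) ^ 2 + 1) * u = C₁' * u * ((u + v) ^ 2 + 1) := by ring
      have e2 : 5 * C₁' * u ^ 3 = C₁' * u * (5 * u ^ 2) := by ring
      rw [e1, e2]; exact h5
    linarith
  have hsmall1 : 2 * C₁' / u ≤ 1 / 2 := by rw [div_le_iff₀ hu0]; linarith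
  have hsmall2 : 5 * C₁' / u ≤ 1 / 2 := by rw [div_le_iff₀ hu0]; linarith
  have hsmallR : CR / u ≤ 1 / 2 := by rw [div_le_iff₀ hu0]; linarith
  -- logarithms
  obtain ⟨hΨ1pos, hL1'⟩ := abs_log_sub_log_le_of_abs_sub_le hm1 (by positivity) hsmall1
    (hP1.trans (mul_le_mul_of_nonneg_right hE1 hm1.le))
  obtain ⟨hΨ2pos, hL2'⟩ := abs_log_sub_log_le_of_abs_sub_le hm2 (by positivity) hsmall2
    (hP2.trans (mul_le_mul_of_nonneg_right hE2 hm2.le))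
  have hL3' := (abs_log_sub_log_le_of_abs_sub_le hρ1 (by positivity) hsmallR hR1).2
  have hlm1 : Real.log (x * dickmanRho u) = u * L + Real.log (dickmanRho u) := by
    rw [Real.log_mul hx0.ne' hρ1.ne', hlogx]
  have hlm2 : Real.log (c * x * dickmanRho (u + v)) = (u + v) * L + Real.log (dickmanRho (u + v)) := by
    rw [Real.log_mul hcx0.ne' hρ2.ne', hlogcx]
  have hlm3 : Real.log (dickmanRho (u + v) * Real.exp (v * dickmanXi u)) = Real.log (dickmanRho (u + v)) + v * dickmanXi u := by
    rw [Real.log_mul hρ2.ne' (Real.exp_pos _).ne', Real.log_exp]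
  rw [hlm3] at hL3'
  -- `T = log Ψ(cx) - log Ψ(x) - α log c`
  set Ψ₁ := ((Nat.smoothNumbersUpTo ⌊x⌋₊ (y + 1)).card : ℝ) with hΨ₁
  set Ψ₂ := ((Nat.smoothNumbersUpTo ⌊c * x⌋₊ (y + 1)).card : ℝ) with hΨ₂
  have hT : Real.log Ψ₂ - Real.log Ψ₁ - Real.log (c ^ α) =
      (Real.log Ψ₂ - Real.log (c * x * dickmanRho (u + v))) - (Real.log Ψ₁ - Real.log (x * dickmanRho u))
      + (Real.log (dickmanRho (u + v)) + v * dickmanXi u - Real.log (dickmanRho u))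
      + v * ((1 - α) * L - dickmanXi u) := by
    rw [Real.log_rpow hc0, hlm1, hlm2, hlogc]; ring
  have hΞv : |v * ((1 - α) * L - dickmanXi u)| ≤ Cξ' / u := by
    rw [abs_mul, abs_of_nonneg hv0]
    have h1 : |(1 - α) * L - dickmanXi u| ≤ Cξ' * u / L :=
      hΞ1.trans (div_le_div_of_nonneg_right (mul_le_mul_of_nonneg_right (le_max_left _ _) hu0.le) hL0.le)
    have h2 : Cξ' * u / L ≤ Cξ' / u := by
      rw [div_le_div_iff₀ hL0 hu0]
      have h3 : u ^ 2 ≤ u ^ 3 := pow_le_pow_right₀ hu1 (by norm_num)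
      have h4 := mul_le_mul_of_nonneg_left (h3.trans hu3') hCξ'0
      have e : Cξ' * u * u = Cξ' * u ^ 2 := by ring
      rw [e]; exact h4
    calc v * |(1 - α) * L - dickmanXi u| ≤ 1 * (Cξ' / u) := mul_le_mul hv1 (h1.trans h2) (abs_nonneg _) zero_le_one
      _ = Cξ' / u := one_mul _
  have hTabs : |Real.log Ψ₂ - Real.log Ψ₁ - Real.log (c ^ α)| ≤ Kstar / u := by
    rw [hT]
    have e : Kstar / u = 2 * (5 * C₁' / u) + 2 * (2 * C₁' / u) + 2 * (CR / u) + Cξ' / u + (10 * C₁' + 1) / u := by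
      rw [hKstar]; field_simp; ring
    have hpos : 0 ≤ (10 * C₁' + 1) / u := by positivity
    rw [e]
    refine (abs_add_le _ _).trans ?_
    refine (add_le_add ((abs_add_le _ _).trans (add_le_add ((abs_sub _ _).trans (add_le_add hL2' hL1')) hL3')) hΞv).trans ?_
    linarith
  have hT1 : Kstar / u ≤ 1 := (div_le_one hu0).2 huK
  -- exponentiate
  have hcα : 0 < c ^ α := Real.rpow_pos_of_pos hc0 _
  have hfin := abs_sub_mul_le_of_abs_log_le hΨ1pos hΨ2pos hcα hT1 hTabs
  refine hfin.trans (mul_le_mul_of_nonneg_right ?_ (mul_nonneg hcα.le hΨ1pos.le))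
  rw [hudef, hL]
  have : 2 * (Kstar / (Real.log x / Real.log y)) = 2 * Kstar * (Real.log y / Real.log x) := by
    field_simp
  rw [this]

set_option maxHeartbeats 3000000 in
/-- **Local behaviour in the polylogarithmic saddle range.** There are `K`, `y₀`, `u₀` such that for `y ≥ y₀`,
`y ≤ x`, `8 (log x)³ ≤ y`, `u₀ ≤ u`, `(log log y)³ ≤ u` (`u = log x/log y`) and `1 ≤ c ≤ y`:
`|Ψ(cx, y) - c^{α(x,y)} Ψ(x, y)| ≤ (K log y/log x) c^{α(x,y)} Ψ(x, y)`.
[cite: HildebrandTenenbaum1986, Theorem 3 and §6 (6.2)–(6.6)] -/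
theorem exists_local_regimeA :
    ∃ K : ℝ, ∃ y₀ : ℕ, ∃ u₀ : ℝ, 0 < K ∧ 1 ≤ u₀ ∧ ∀ (x : ℝ) (y : ℕ) (c : ℝ), y₀ ≤ y → (y : ℝ) ≤ x →
      8 * Real.log x ^ 3 ≤ y → u₀ ≤ Real.log x / Real.log y →
      Real.log (Real.log y) ^ 3 ≤ Real.log x / Real.log y → 1 ≤ c → c ≤ y →
      |((Nat.smoothNumbersUpTo ⌊c * x⌋₊ (y + 1)).card : ℝ) -
          c ^ saddlePoint x y * ((Nat.smoothNumbersUpTo ⌊x⌋₊ (y + 1)).card : ℝ)| ≤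
        K * (Real.log y / Real.log x) *
          (c ^ saddlePoint x y * ((Nat.smoothNumbersUpTo ⌊x⌋₊ (y + 1)).card : ℝ)) := by
  obtain ⟨CA, yA, uA, hA⟩ := exists_card_smooth_saddle_regimeA
  obtain ⟨K, yK, hK0, hyK2, hM⟩ := exists_abs_log_mainTerm_sub_le
  set CA' := max CA 0 with hCA'
  have hCA'0 : 0 ≤ CA' := le_max_right _ _
  set Kstar : ℝ := 4 * CA' + K with hKstar
  have hKstar0 : 0 < Kstar := by positivity
  refine ⟨2 * Kstar, max (max yA yK) 16, max (max 2 uA) (max (2 * CA') Kstar), by positivity,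
    le_trans one_le_two (le_trans (le_max_left _ _) (le_max_left _ _)), ?_⟩
  intro x y c hy hyx h8 hu hll hc1 hcy
  have hyA : yA ≤ y := le_trans (le_trans (le_max_left _ _) (le_max_left _ _)) hy
  have hyK : yK ≤ y := le_trans (le_trans (le_max_right _ _) (le_max_left _ _)) hy
  have hy16 : 16 ≤ y := le_trans (le_max_right _ _) hy
  set L := Real.log y with hL
  set u := Real.log x / L with hudef
  have hu2 : 2 ≤ u := le_trans (le_max_left _ _) (le_trans (le_max_left _ _) hu)
  have huA : uA ≤ u := le_trans (le_max_right _ _) (le_trans (le_max_left _ _) hu)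
  have huCA : 2 * CA' ≤ u := le_trans (le_max_left _ _) (le_trans (le_max_right _ _) hu)
  have huK : Kstar ≤ u := le_trans (le_max_right _ _) (le_trans (le_max_right _ _) hu)
  have hu1 : 1 ≤ u := by linarith
  have hu0 : 0 < u := by linarith
  have hy16r : (16 : ℝ) ≤ y := by exact_mod_cast hy16
  have hy0 : (0 : ℝ) < y := by linarith
  have hy1 : (1 : ℝ) < y := by linarith
  have hy2 : 2 ≤ y := le_trans (by norm_num) hy16
  have hL1 : 1 < L := by
    rw [hL, Real.lt_log_iff_exp_lt hy0]
    exact lt_of_lt_of_le (Real.exp_one_lt_d9.trans (by norm_num)) hy16r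
  have hL0 : 0 < L := by linarith
  have hx1 : 1 < x := by linarith
  have hx0 : 0 < x := by linarith
  have hc0 : 0 < c := by linarith
  have hcx0 : 0 < c * x := by positivity
  have hlogx : Real.log x = u * L := by rw [hudef]; field_simp
  set v := Real.log c / L with hv
  have hv0 : 0 ≤ v := div_nonneg (Real.log_nonneg hc1) hL0.le
  have hv1 : v ≤ 1 := by rw [hv, div_le_one hL0]; exact Real.log_le_log hc0 hcy
  have hlogc : Real.log c = v * L := by rw [hv]; field_simp
  have hlogcx : Real.log (c * x) = (u + v) * L := by rw [Real.log_mul hc0.ne' hx0.ne', hlogx, hlogc]; ring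
  have hucx : Real.log (c * x) / L = u + v := by rw [hlogcx]; field_simp
  have hycx : (y : ℝ) ≤ c * x := hyx.trans (le_mul_of_one_le_left hx0.le hc1)
  have hcx1 : 1 < c * x := lt_of_lt_of_le hy1 hycx
  -- Theorem 1 at `x` and `cx`
  have hlogx3 : Real.log x ^ 3 ≤ y := by
    have : 0 ≤ Real.log x ^ 3 := pow_nonneg (Real.log_pos hx1).le 3
    linarith
  have hlogcx3 : Real.log (c * x) ^ 3 ≤ y := by
    have h1 : Real.log (c * x) ≤ 2 * Real.log x := by
      rw [hlogcx, hlogx]; nlinarith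
    have h2 : Real.log (c * x) ^ 3 ≤ (2 * Real.log x) ^ 3 :=
      pow_le_pow_left₀ (Real.log_pos hcx1).le h1 3
    nlinarith
  have hA1 := hA x y hyA hlogx3 hyx (by rw [← hL, ← hudef]; exact huA) (by rw [← hL, ← hudef]; exact hll)
  have hA2 := hA (c * x) y hyA hlogcx3 hycx (by rw [← hL, hucx]; linarith) (by rw [← hL, hucx]; linarith)
  rw [← hL, ← hudef] at hA1
  rw [← hL, hucx] at hA2
  have hM1 := hM x y c hyK hyx hc1 hcy
  rw [← hL, hlogx] at hM1
  set α := saddlePoint x y with hα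
  set α₂ := saddlePoint (c * x) y with hα₂
  have hαpos : 0 < α := saddlePoint_pos hx1 hy2
  have hα₂pos : 0 < α₂ := saddlePoint_pos hcx1 hy2
  set M₁ := x ^ α * smoothZeta α y / (α * Real.sqrt (2 * Real.pi * saddlePhi₂ α y)) with hM₁
  set M₂ := (c * x) ^ α₂ * smoothZeta α₂ y / (α₂ * Real.sqrt (2 * Real.pi * saddlePhi₂ α₂ y)) with hM₂
  have hM₁0 : 0 < M₁ := by
    have := smoothZeta_pos (y := y) hαpos
    have := saddlePhi₂_pos hy2 hαpos
    positivity
  have hM₂0 : 0 < M₂ := by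
    have := smoothZeta_pos (y := y) hα₂pos
    have := saddlePhi₂_pos hy2 hα₂pos
    positivity
  have hEA1 : CA / u ≤ CA' / u := div_le_div_of_nonneg_right (le_max_left _ _) hu0.le
  have hEA2 : CA / (u + v) ≤ CA' / u :=
    (div_le_div_of_nonneg_right (le_max_left _ _) (by linarith)).trans
      (div_le_div_of_nonneg_left hCA'0 hu0 (by linarith))
  have hsmallA : CA' / u ≤ 1 / 2 := by rw [div_le_iff₀ hu0]; linarith
  obtain ⟨hΨ1pos, hL3'⟩ := abs_log_sub_log_le_of_abs_sub_le hM₁0 (by positivity) hsmallA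
    (hA1.trans (mul_le_mul_of_nonneg_right hEA1 hM₁0.le))
  obtain ⟨hΨ2pos, hL4'⟩ := abs_log_sub_log_le_of_abs_sub_le hM₂0 (by positivity) hsmallA
    (hA2.trans (mul_le_mul_of_nonneg_right hEA2 hM₂0.le))
  have hlM₁ : Real.log M₁ = α * Real.log x + Real.log (smoothZeta α y) - Real.log α -
      1 / 2 * Real.log (2 * Real.pi * saddlePhi₂ α y) := log_mainTerm_eq hx1 hy2 hαpos
  have hlM₂ : Real.log M₂ = α₂ * Real.log (c * x) + Real.log (smoothZeta α₂ y) - Real.log α₂ -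
      1 / 2 * Real.log (2 * Real.pi * saddlePhi₂ α₂ y) := log_mainTerm_eq hcx1 hy2 hα₂pos
  have hL5 : |Real.log M₂ - Real.log M₁ - α * Real.log c| ≤ K / u := by
    rw [hlM₁, hlM₂, hlogx]
    have : K * (L / (u * L)) = K / u := by field_simp
    rw [this] at hM1
    exact hM1
  set Ψ₁ := ((Nat.smoothNumbersUpTo ⌊x⌋₊ (y + 1)).card : ℝ) with hΨ₁
  set Ψ₂ := ((Nat.smoothNumbersUpTo ⌊c * x⌋₊ (y + 1)).card : ℝ) with hΨ₂
  have hT : Real.log Ψ₂ - Real.log Ψ₁ - Real.log (c ^ α) =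
      (Real.log Ψ₂ - Real.log M₂) - (Real.log Ψ₁ - Real.log M₁) + (Real.log M₂ - Real.log M₁ - α * Real.log c) := by
    rw [Real.log_rpow hc0]; ring
  have hTabs : |Real.log Ψ₂ - Real.log Ψ₁ - Real.log (c ^ α)| ≤ Kstar / u := by
    rw [hT]
    have e : Kstar / u = 2 * (CA' / u) + 2 * (CA' / u) + K / u := by rw [hKstar]; field_simp; ring
    rw [e]
    exact (abs_add_le _ _).trans (add_le_add ((abs_sub _ _).trans (add_le_add hL4' hL3')) hL5)
  have hT1 : Kstar / u ≤ 1 := (div_le_one hu0).2 huK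
  have hcα : 0 < c ^ α := Real.rpow_pos_of_pos hc0 _
  have hfin := abs_sub_mul_le_of_abs_log_le hΨ1pos hΨ2pos hcα hT1 hTabs
  refine hfin.trans (mul_le_mul_of_nonneg_right ?_ (mul_nonneg hcα.le hΨ1pos.le))
  rw [hudef, hL]
  have : 2 * (Kstar / (Real.log x / Real.log y)) = 2 * Kstar * (Real.log y / Real.log x) := by
    field_simp
  rw [this]

end Literature.NumberTheory.Sieve

end
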